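import Mathlib
import Literature.Combinatorics.SimpleGraph.HamiltonianCycleListings
import Literature.Combinatorics.SimpleGraph.HamiltonianSubdivision
import Summits.PneNP.PneNP.Theorems.SymmetryBudgetWindowBarrierCoreReduction

/-!
# Hamiltonian paths of the free part versus Hamiltonian cycles of the planted graph
(helper for item stmt-PneNP-2148 `SymmetryBudget.PolylogHam`, route route-PneNP-SymmetryBudget)

The proof of `PolylogHam` restricts a `Bud(n+g, g)`-symmetric HAM circuit on `(n+g) × (n+g)`
matrix inputs to the PLANTED inputs: the ordered part `{0, …, n-1}` is hard-wired to the path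
`0 — 1 — ⋯ — (n-1)` whose two ends `0` and `n-1` are joined to every free vertex `n + j`, and
the free block carries the adjacency matrix of a graph `G` on `Fin g`. This file proves the
combinatorial heart of that restriction, for an abstract graph `Φ` on `Fin (n + g)` with exactly
this adjacency pattern (`n ≥ 3`, `g ≥ 1`):

  `Φ` is Hamiltonian (Mathlib's `SimpleGraph.IsHamiltonian`) iff `G` has a HAMILTONIAN PATH,

the latter in listing form — a duplicate-free, exhaustive `G.Adj`-chain `l : List (Fin g)`
(`planted_isHamiltonian_iff`). Hamiltonian cycles are handled through the tree's cyclic vertex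
listings (`Literature.Combinatorics.SimpleGraph.IsHamCycleListing`,
`isHamiltonian_iff_of_three_le_card`): a Hamiltonian cycle of `Φ` is rotated to end in the
degree-two vertex `1`, whose neighbours `0`, `2` are then the two ends of the remaining path
(`ends_of_two_nbrs`); degree-two forcing along `2, 3, …, n-1` shows that the ordered path is
traversed as one block, so the free vertices form one contiguous `G`-chain. Also: reversal of
cyclic listings and transport of path listings along maps. Folklore (Garey–Johnson–Tarjan 1976,
§2, degree-two forcing). No definitions are introduced (kernel-only helper file); the free index
`n + j` is the term `⟨n + j, CoreReduction.freeIdx_lt n j⟩` of the core reduction file.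
-/

-- `Summit.PneNP.PneNP.…` duplicates `PneNP` BY DESIGN (single-problem summit).
set_option linter.dupNamespace false

namespace Summit.PneNP.PneNP.Theorems

namespace PolylogHam

open Literature.Combinatorics.SimpleGraph CoreReduction

variable {α β : Type*}

/-! ### Generic facts on listings -/

/-- **Reversing a cyclic listing of a symmetric relation gives a cyclic listing.** -/
theorem isHamCycleListing_reverse {R : α → α → Prop} (hR : ∀ a b, R a b → R b a) {l : List α}
    (h : IsHamCycleListing R l) : IsHamCycleListing R l.reverse := by
  rw [isHamCycleListing_iff_isChain] at h ⊢
  obtain ⟨hnd, hall, hch, hwrap⟩ := h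
  refine ⟨List.nodup_reverse.2 hnd, fun v => List.mem_reverse.2 (hall v), ?_, fun hl => ?_⟩
  · rw [List.isChain_reverse]
    exact List.IsChain.imp (fun a b hab => hR a b hab) hch
  · have hl' : l ≠ [] := by simpa using hl
    rw [List.getLast_reverse, List.head_reverse]
    exact hR _ _ (hwrap hl')

/-- **Transport of Hamiltonian-path listings along a map**: if `f` is injective, every `b` is
some `f a`, and `f` carries `R` into `S`, then an exhaustive duplicate-free `R`-chain maps to an
exhaustive duplicate-free `S`-chain. -/
theorem exists_hamPath_map {R : α → α → Prop} {S : β → β → Prop} (f : α → β)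
    (hf : Function.Injective f) (hsurj : ∀ b, ∃ a, f a = b) (hRS : ∀ a b, R a b → S (f a) (f b))
    (h : ∃ l : List α, l.Nodup ∧ (∀ v, v ∈ l) ∧ List.IsChain R l) :
    ∃ l : List β, l.Nodup ∧ (∀ v, v ∈ l) ∧ List.IsChain S l := by
  obtain ⟨l, hnd, hall, hch⟩ := h
  refine ⟨l.map f, hnd.map hf, fun b => ?_, List.isChain_map_of_isChain f hRS hch⟩
  obtain ⟨a, rfl⟩ := hsurj b
  exact List.mem_map_of_mem (hall a)

/-- Transport of Hamiltonian-path listings along a graph isomorphism. -/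
theorem exists_hamPath_of_iso {G : SimpleGraph α} {H : SimpleGraph β} (e : G ≃g H)
    (h : ∃ l : List α, l.Nodup ∧ (∀ v, v ∈ l) ∧ List.IsChain G.Adj l) :
    ∃ l : List β, l.Nodup ∧ (∀ v, v ∈ l) ∧ List.IsChain H.Adj l :=
  exists_hamPath_map e e.injective (fun b => ⟨e.symm b, e.apply_symm_apply b⟩)
    (fun _ _ hab => e.map_adj_iff.2 hab) h

/-! ### The planted graph -/

section Planted

variable {n g : ℕ} (G : SimpleGraph (Fin g)) (Φ : SimpleGraph (Fin (n + g)))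

/-- **From a Hamiltonian path of `G` to a Hamiltonian cycle of the planted graph**: the ordered
path `0, 1, …, n-1` followed by the free copy of the path listing of `G` is a cyclic listing. -/
theorem planted_isHamiltonian_of_hamPath (hn : 1 ≤ n) (hg : 1 ≤ g) (hng : 3 ≤ n + g)
    (hFF : ∀ j j' : Fin g, Φ.Adj ⟨n + j, freeIdx_lt n j⟩ ⟨n + j', freeIdx_lt n j'⟩ ↔ G.Adj j j')
    (hOO : ∀ i i' : Fin (n + g), (i : ℕ) < n → (i' : ℕ) < n →
      (Φ.Adj i i' ↔ (i : ℕ) + 1 = i' ∨ (i' : ℕ) + 1 = i))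
    (hOF : ∀ (i : Fin (n + g)) (j : Fin g), (i : ℕ) < n →
      (Φ.Adj i ⟨n + j, freeIdx_lt n j⟩ ↔ (i : ℕ) = 0 ∨ (i : ℕ) = n - 1))
    (h : ∃ l : List (Fin g), l.Nodup ∧ (∀ v, v ∈ l) ∧ List.IsChain G.Adj l) :
    Φ.IsHamiltonian := by
  classical
  obtain ⟨l, hnd, hall, hch⟩ := h
  -- the free copy of `l` and the ordered path
  let fr : Fin g → Fin (n + g) := fun j => ⟨n + j, freeIdx_lt n j⟩
  have hfr_inj : Function.Injective fr := fun j j' e => by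
    simp only [fr, Fin.mk.injEq] at e; exact Fin.ext (by omega)
  let od : Fin n → Fin (n + g) := fun i => ⟨i, by omega⟩
  have hod_inj : Function.Injective od := fun i i' e => by
    simp only [od, Fin.mk.injEq] at e; exact Fin.ext e
  have hl0 : l ≠ [] := List.ne_nil_of_mem (hall ⟨0, hg⟩)
  have hn0 : List.finRange n ≠ [] := List.ne_nil_of_mem (List.mem_finRange (⟨0, hn⟩ : Fin n))
  set P : List (Fin (n + g)) := (List.finRange n).map od with hP
  set Q : List (Fin (n + g)) := l.map fr with hQ
  have hP0 : P ≠ [] := by simpa [hP] using hn0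
  have hQ0 : Q ≠ [] := by simpa [hQ] using hl0
  have hPlen : P.length = n := by simp [hP]
  have hPget : ∀ (i : ℕ) (hi : i < P.length), (P[i] : ℕ) = i := fun i hi => by
    simp [hP, od]
  -- the listing
  have hL : IsHamCycleListing Φ.Adj (P ++ Q) := by
    rw [isHamCycleListing_iff_isChain]
    refine ⟨?_, ?_, ?_, ?_⟩
    · refine List.Nodup.append ((List.nodup_finRange n).map hod_inj) (hnd.map hfr_inj) ?_
      intro v hvP hvQ
      simp only [hP, hQ, List.mem_map, List.mem_finRange, true_and] at hvP hvQ
      obtain ⟨i, rfl⟩ := hvP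
      obtain ⟨j, -, hj⟩ := hvQ
      have := congrArg Fin.val hj
      simp only [fr, od] at this
      omega
    · intro v
      by_cases hv : (v : ℕ) < n
      · refine List.mem_append_left _ ?_
        simp only [hP, List.mem_map, List.mem_finRange, true_and]
        exact ⟨⟨v, hv⟩, Fin.ext rfl⟩
      · refine List.mem_append_right _ ?_
        simp only [hQ, List.mem_map]
        refine ⟨⟨v - n, by omega⟩, hall _, Fin.ext ?_⟩
        simp only [fr]
        omega
    · refine List.IsChain.append ?_ ?_ ?_
      · rw [List.isChain_iff_getElem]
        intro i hi
        rw [hOO _ _ (by rw [hPget]; omega) (by rw [hPget]; omega), hPget, hPget]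
        exact Or.inl rfl
      · rw [hQ]
        exact List.isChain_map_of_isChain fr (fun a b hab => (hFF a b).2 hab) hch
      · intro x hx y hy
        rw [List.getLast?_eq_some_getLast hP0, Option.mem_def, Option.some.injEq] at hx
        rw [List.head?_eq_some_head hQ0, Option.mem_def, Option.some.injEq] at hy
        subst hx hy
        have hy' : Q.head hQ0 = fr (l.head hl0) := by simp [hQ]
        rw [hy', hOF _ _ (by rw [List.getLast_eq_getElem, hPget]; omega)]
        right
        rw [List.getLast_eq_getElem, hPget, hPlen]
    · intro hl
      have h1 : (P ++ Q).getLast hl = Q.getLast hQ0 := List.getLast_append_of_ne_nil _ hQ0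
      have h2 : (P ++ Q).head hl = P.head hP0 := List.head_append_of_ne_nil hP0
      have h3 : Q.getLast hQ0 = fr (l.getLast hl0) := by simp [hQ, List.getLast_map]
      rw [h1, h2, h3]
      have hh : ((P.head hP0 : Fin (n + g)) : ℕ) = 0 := by rw [List.head_eq_getElem, hPget]
      exact Φ.adj_symm ((hOF _ _ (by rw [hh]; omega)).2 (Or.inl hh))
  refine hL.isHamiltonian ?_
  rw [List.length_append, hPlen, hQ, List.length_map]
  have := List.length_pos_of_ne_nil hl0
  have hlen : l.length = g := by
    have huniv : l.toFinset = Finset.univ :=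
      Finset.eq_univ_iff_forall.2 fun v => List.mem_toFinset.2 (hall v)
    rw [← List.toFinset_card_of_nodup hnd, huniv, Finset.card_univ, Fintype.card_fin]
  omega

/-- Neighbours in the planted graph of an ordered vertex `k < n`: an ordered vertex `k ± 1`, or —
only for the two ends `k = 0`, `k = n - 1` — a free vertex. -/
theorem planted_nbr
    (hOO : ∀ i i' : Fin (n + g), (i : ℕ) < n → (i' : ℕ) < n →
      (Φ.Adj i i' ↔ (i : ℕ) + 1 = i' ∨ (i' : ℕ) + 1 = i))
    (hOF : ∀ (i : Fin (n + g)) (j : Fin g), (i : ℕ) < n →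
      (Φ.Adj i ⟨n + j, freeIdx_lt n j⟩ ↔ (i : ℕ) = 0 ∨ (i : ℕ) = n - 1))
    {i x : Fin (n + g)} (hi : (i : ℕ) < n) (hx : Φ.Adj i x) :
    ((x : ℕ) < n ∧ ((x : ℕ) + 1 = i ∨ (i : ℕ) + 1 = x)) ∨
      (n ≤ (x : ℕ) ∧ ((i : ℕ) = 0 ∨ (i : ℕ) = n - 1)) := by
  by_cases hxn : (x : ℕ) < n
  · left
    refine ⟨hxn, ?_⟩
    have := (hOO i x hi hxn).1 hx
    omega
  · right
    refine ⟨Nat.le_of_not_lt hxn, ?_⟩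
    have hx' : x = ⟨n + ((⟨(x : ℕ) - n, by omega⟩ : Fin g) : ℕ), freeIdx_lt n _⟩ :=
      Fin.ext (by show (x : ℕ) = n + ((x : ℕ) - n); omega)
    rw [hx'] at hx
    exact (hOF i _ hi).1 hx

/-- **The core of the extraction.** If `M ++ [1]` is a cyclic listing of the planted graph whose
path part `M` starts at `2` and ends at `0` (`n ≥ 3`, `g ≥ 1`), then the free vertices occupy the
positions `n-2, …, n+g-3` of `M` consecutively, and read off there they form a Hamiltonian path
listing of `G`. -/
theorem hamPath_of_listing (hn : 3 ≤ n) (hg : 1 ≤ g)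
    (hFF : ∀ j j' : Fin g, Φ.Adj ⟨n + j, freeIdx_lt n j⟩ ⟨n + j', freeIdx_lt n j'⟩ ↔ G.Adj j j')
    (hOO : ∀ i i' : Fin (n + g), (i : ℕ) < n → (i' : ℕ) < n →
      (Φ.Adj i i' ↔ (i : ℕ) + 1 = i' ∨ (i' : ℕ) + 1 = i))
    (hOF : ∀ (i : Fin (n + g)) (j : Fin g), (i : ℕ) < n →
      (Φ.Adj i ⟨n + j, freeIdx_lt n j⟩ ↔ (i : ℕ) = 0 ∨ (i : ℕ) = n - 1))
    (M : List (Fin (n + g))) (hL : IsHamCycleListing Φ.Adj (M ++ [⟨1, by omega⟩]))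
    (hM0 : M ≠ []) (hhead : ((M.head hM0 : Fin (n + g)) : ℕ) = 2)
    (hlast : ((M.getLast hM0 : Fin (n + g)) : ℕ) = 0) :
    ∃ l : List (Fin g), l.Nodup ∧ (∀ v, v ∈ l) ∧ List.IsChain G.Adj l := by
  -- bookkeeping on `M`
  have hlen : M.length = n + g - 1 := by
    have := hL.length_eq
    rw [List.length_append, List.length_singleton, Fintype.card_fin] at this
    omega
  have hnd : M.Nodup := (List.nodup_append'.1 hL.nodup).1
  have ho1 : (⟨1, by omega⟩ : Fin (n + g)) ∉ M := fun h1 =>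
    (List.nodup_append'.1 hL.nodup).2.2 h1 (List.mem_singleton_self _)
  have hval1 : ∀ (i : ℕ) (hi : i < M.length), ((M[i] : Fin (n + g)) : ℕ) ≠ 1 := by
    intro i hi h1
    exact ho1 (by
      have : M[i] = ⟨1, by omega⟩ := Fin.ext h1
      exact this ▸ List.getElem_mem hi)
  have hget : ∀ (i : ℕ) (hi : i < M.length),
      (M ++ [(⟨1, by omega⟩ : Fin (n + g))])[i]'(by simp; omega) = M[i] :=
    fun i hi => List.getElem_append_left hi
  have hsucc : ∀ (i : ℕ) (hi : i + 1 < M.length), Φ.Adj M[i] M[i + 1] := by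
    intro i hi
    have := hL.rel_succ i (by simp; omega)
    rwa [hget i (by omega), hget (i + 1) hi] at this
  have hinj : ∀ (i i' : ℕ) (hi : i < M.length) (hi' : i' < M.length),
      ((M[i] : Fin (n + g)) : ℕ) = M[i'] → i = i' := fun i i' hi hi' h =>
    (hnd.getElem_inj_iff).1 (Fin.ext h)
  have hM0val : ((M[0]'(by omega) : Fin (n + g)) : ℕ) = 2 := by
    rw [← List.head_eq_getElem hM0]; exact hhead
  have hMlast : ((M[M.length - 1]'(by have := List.length_pos_of_ne_nil hM0; omega) :
      Fin (n + g)) : ℕ) = 0 := by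
    rw [← List.getLast_eq_getElem hM0]; exact hlast
  -- degree-two forcing along the ordered path: `M[j] = j + 2` for `j + 3 ≤ n`
  have hord : ∀ (i j : ℕ), j ≤ i → ∀ hj : j + 3 ≤ n,
      ((M[j]'(by omega) : Fin (n + g)) : ℕ) = j + 2 := by
    intro i
    induction i with
    | zero =>
      intro j hj _
      obtain rfl : j = 0 := by omega
      exact hM0val
    | succ i ih =>
      intro j hj hjn
      rcases Nat.lt_or_ge j (i + 1) with hlt | hge
      · exact ih j (by omega) hjn
      obtain rfl : j = i + 1 := by omega
      have hi : ((M[i]'(by omega) : Fin (n + g)) : ℕ) = i + 2 := ih i le_rfl (by omega)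
      have hadj := hsucc i (by omega)
      rcases planted_nbr Φ hOO hOF (i := M[i]) (x := M[i + 1]) (by rw [hi]; omega) hadj with
        ⟨-, h⟩ | ⟨-, h⟩
      · rw [hi] at h
        rcases h with h | h
        · -- `M[i+1] = i + 1`: the predecessor `i + 1` of `i + 2` is `M[i-1]` (or the vertex `1`)
          exfalso
          rcases Nat.eq_zero_or_pos i with rfl | hi0
          · exact hval1 (0 + 1) (by omega) (by omega)
          · have hprev : ((M[i - 1]'(by omega) : Fin (n + g)) : ℕ) = i + 1 := by
              have := ih (i - 1) (by omega) (by omega)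
              rw [this]; omega
            have := hinj (i + 1) (i - 1) (by omega) (by omega) (by omega)
            omega
        · omega
      · rw [hi] at h
        omega
  replace hord : ∀ (j : ℕ) (hj : j + 3 ≤ n), ((M[j]'(by omega) : Fin (n + g)) : ℕ) = j + 2 :=
    fun j hj => hord j j le_rfl hj
  -- the positions `n-2, …, n+g-3` carry free vertices
  have hfree : ∀ (i : ℕ), n - 2 ≤ i → ∀ hi : i + 1 < M.length, n ≤ ((M[i] : Fin (n + g)) : ℕ) := by
    intro i hi1 hi2
    by_contra hlt
    have hk : ((M[i] : Fin (n + g)) : ℕ) < n := Nat.lt_of_not_le hlt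
    rcases Nat.lt_or_ge ((M[i] : Fin (n + g)) : ℕ) 2 with h2 | h2
    · rcases Nat.lt_or_ge ((M[i] : Fin (n + g)) : ℕ) 1 with h1 | h1
      · -- value `0`: this is the last entry
        have := hinj i (M.length - 1) (by omega) (by omega) (by rw [hMlast]; omega)
        omega
      · exact hval1 i (by omega) (by omega)
    · -- value `k ≥ 2`: this is the entry at position `k - 2 ≤ n - 3`
      have h3 := hord (((M[i] : Fin (n + g)) : ℕ) - 2) (by omega)
      have := hinj i (((M[i] : Fin (n + g)) : ℕ) - 2) (by omega) (by omega) (by rw [h3]; omega)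
      omega
  -- the free block, read back in `Fin g`
  have hidx : ∀ j : Fin g, n - 2 + (j : ℕ) < M.length := fun j => by have := j.2; omega
  let f : Fin g → Fin g := fun j =>
    ⟨((M[n - 2 + (j : ℕ)]'(hidx j) : Fin (n + g)) : ℕ) - n, by
      have := (M[n - 2 + (j : ℕ)]'(hidx j)).2; have := j.2; omega⟩
  have hfval : ∀ j : Fin g, n + ((f j : Fin g) : ℕ) = ((M[n - 2 + (j : ℕ)]'(hidx j) : Fin (n + g)) : ℕ) := by
    intro j
    have := hfree (n - 2 + j) (by omega) (by have := j.2; omega)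
    simp only [f]
    omega
  have hfvtx : ∀ j : Fin g, (⟨n + ((f j : Fin g) : ℕ), freeIdx_lt n (f j)⟩ : Fin (n + g)) =
      M[n - 2 + (j : ℕ)]'(hidx j) := fun j => Fin.ext (hfval j)
  refine ⟨(List.finRange g).map f, (List.nodup_finRange g).map ?_, fun v => ?_, ?_⟩
  · -- injective
    intro j j' hjj'
    have h1 := hfval j
    have h2 := hfval j'
    rw [hjj'] at h1
    have := hinj (n - 2 + j) (n - 2 + j') (hidx j) (hidx j') (by omega)
    exact Fin.ext (by omega)
  · -- exhaustive: the free vertex `n + v` occurs in `M`, necessarily in the free block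
    have hv : (⟨n + (v : ℕ), freeIdx_lt n v⟩ : Fin (n + g)) ∈ M := by
      have := hL.mem ⟨n + (v : ℕ), freeIdx_lt n v⟩
      rw [List.mem_append, List.mem_singleton] at this
      refine this.resolve_right fun h => ?_
      have := congrArg Fin.val h
      dsimp only at this
      omega
    obtain ⟨i, hi, hiv⟩ := List.getElem_of_mem hv
    have hvi : ((M[i] : Fin (n + g)) : ℕ) = n + v := by rw [hiv]
    have hi1 : n - 2 ≤ i := by
      by_contra hlt
      have := hord i (by omega)
      omega
    have hi2 : i + 1 < M.length := by
      by_contra hge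
      have hii : i = M.length - 1 := by omega
      subst hii
      rw [hMlast] at hvi
      omega
    rw [List.mem_map]
    refine ⟨⟨i - (n - 2), by omega⟩, List.mem_finRange _, Fin.ext ?_⟩
    have h1 := hfval ⟨i - (n - 2), by omega⟩
    have h2 : n - 2 + (((⟨i - (n - 2), by omega⟩ : Fin g) : ℕ)) = i := by
      dsimp only; omega
    simp only [h2] at h1
    rw [hvi] at h1
    omega
  · -- chain
    rw [List.isChain_iff_getElem]
    intro j hj
    rw [List.length_map, List.length_finRange] at hj
    simp only [List.getElem_map, List.getElem_finRange]
    rw [← hFF, hfvtx, hfvtx]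
    have := hsucc (n - 2 + j) (by omega)
    convert this using 2
    all_goals first | (simp only [Fin.val_cast]; omega) | simp only [Fin.val_cast]


/-- **From a Hamiltonian cycle of the planted graph to a Hamiltonian path of `G`** (`n ≥ 3`,
`g ≥ 1`): rotate a cyclic listing to end in the degree-two vertex `1`; its path part runs between
the neighbours `0` and `2` of `1` (`ends_of_two_nbrs`), after a reversal from `2` to `0`, and
`hamPath_of_listing` applies. -/
theorem hamPath_of_planted_isHamiltonian (hn : 3 ≤ n) (hg : 1 ≤ g)
    (hFF : ∀ j j' : Fin g, Φ.Adj ⟨n + j, freeIdx_lt n j⟩ ⟨n + j', freeIdx_lt n j'⟩ ↔ G.Adj j j')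
    (hOO : ∀ i i' : Fin (n + g), (i : ℕ) < n → (i' : ℕ) < n →
      (Φ.Adj i i' ↔ (i : ℕ) + 1 = i' ∨ (i' : ℕ) + 1 = i))
    (hOF : ∀ (i : Fin (n + g)) (j : Fin g), (i : ℕ) < n →
      (Φ.Adj i ⟨n + j, freeIdx_lt n j⟩ ↔ (i : ℕ) = 0 ∨ (i : ℕ) = n - 1))
    (h : Φ.IsHamiltonian) :
    ∃ l : List (Fin g), l.Nodup ∧ (∀ v, v ∈ l) ∧ List.IsChain G.Adj l := by
  classical
  obtain ⟨L, hL⟩ := (isHamiltonian_iff_of_three_le_card Φ (by simp; omega)).1 h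
  -- rotate to end in `1`
  obtain ⟨r, M, hrM⟩ := hL.exists_rotate_eq_concat ⟨1, by omega⟩
  have hL1 : IsHamCycleListing Φ.Adj (M ++ [⟨1, by omega⟩]) := hrM ▸ hL.rotate r
  have hlen : M.length = n + g - 1 := by
    have := hL1.length_eq
    rw [List.length_append, List.length_singleton, Fintype.card_fin] at this
    omega
  have hM0 : M ≠ [] := List.ne_nil_of_length_pos (by omega)
  -- the two neighbours `0`, `2` of `1`
  have hz : ∀ x : Fin (n + g), Φ.Adj ⟨1, by omega⟩ x →
      x = ⟨0, by omega⟩ ∨ x = ⟨2, by omega⟩ := by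
    intro x hx
    rcases planted_nbr Φ hOO hOF (i := ⟨1, by omega⟩) (by dsimp only; omega) hx with
      ⟨-, h⟩ | ⟨-, h⟩
    · dsimp only at h
      rcases h with h | h
      · exact Or.inl (Fin.ext (by dsimp only; omega))
      · exact Or.inr (Fin.ext (by dsimp only; omega))
    · dsimp only at h
      omega
  have hends := ends_of_two_nbrs hM0 hL1 (by omega) hz (fun x hx => hz x (Φ.adj_symm hx))
  rcases hends with ⟨hh, hl⟩ | ⟨hh, hl⟩
  · -- `M` runs from `0` to `2`: reverse it
    have hrev : IsHamCycleListing Φ.Adj (M.reverse ++ [⟨1, by omega⟩]) := by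
      have h1 := (isHamCycleListing_reverse (fun a b hab => Φ.adj_symm hab) hL1).rotate 1
      rwa [List.reverse_append, List.reverse_singleton, List.singleton_append,
        List.rotate_cons_succ, List.rotate_zero] at h1
    have hM0' : M.reverse ≠ [] := by simpa using hM0
    refine hamPath_of_listing G Φ hn hg hFF hOO hOF M.reverse hrev hM0' ?_ ?_
    · rw [List.head_reverse, hl]
    · rw [List.getLast_reverse, hh]
  · exact hamPath_of_listing G Φ hn hg hFF hOO hOF M hL1 hM0 (by rw [hh]) (by rw [hl])

/-- **The planted graph is Hamiltonian iff the free part has a Hamiltonian path** (`n ≥ 3`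
ordered vertices on a path whose ends are joined to all `g ≥ 1` free vertices). -/
theorem planted_isHamiltonian_iff (hn : 3 ≤ n) (hg : 1 ≤ g)
    (hFF : ∀ j j' : Fin g, Φ.Adj ⟨n + j, freeIdx_lt n j⟩ ⟨n + j', freeIdx_lt n j'⟩ ↔ G.Adj j j')
    (hOO : ∀ i i' : Fin (n + g), (i : ℕ) < n → (i' : ℕ) < n →
      (Φ.Adj i i' ↔ (i : ℕ) + 1 = i' ∨ (i' : ℕ) + 1 = i))
    (hOF : ∀ (i : Fin (n + g)) (j : Fin g), (i : ℕ) < n →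
      (Φ.Adj i ⟨n + j, freeIdx_lt n j⟩ ↔ (i : ℕ) = 0 ∨ (i : ℕ) = n - 1)) :
    Φ.IsHamiltonian ↔ ∃ l : List (Fin g), l.Nodup ∧ (∀ v, v ∈ l) ∧ List.IsChain G.Adj l :=
  ⟨hamPath_of_planted_isHamiltonian G Φ hn hg hFF hOO hOF,
    planted_isHamiltonian_of_hamPath G Φ (by omega) hg (by omega) hFF hOO hOF⟩

end Planted

end PolylogHam

end Summit.PneNP.PneNP.Theorems
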